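import Literature.NumberTheory.Weil1964.ArchFollandKroneckerDet
import HarnessLib

/-!
# A place definite for `V` and for `W`: invariant Fock polynomials are constants (junction D4 ↔ `D₁₂` places)

Topic `NumberTheory/Weil1964`; namespace `Literature.NumberTheory.Weil1964`.  Proved lemmas only: **no named facts, no
records, 0 proof holes**.  Setting of LEAF D4 / `ArchFollandKroneckerDet`: Folland variables `e : p × m ≃ ι`, product
scaling `D = D₀ ⊗ D₁` (`D₀, D₁ ≠ 0`), and a sign vector which is CONSTANT on the whole place
(`ε (e (a, j)) = s₀`: both `V` and `W` definite there — the places of kind `D₁₂` of the pub-hodgecm cell).  The centre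
`u · 1` (`|u| = 1`) of the compact group `U(V_b)` is form-preserving and sign-block, and its Folland substitution
scales EVERY variable of the place by the same unimodular scalar; so a polynomial fixed by all form-preserving
sign-block elements has total degree `0`:

* `linSubst_star_follandUnitary_kronecker_scalar`: the substitution of `u · 1` is `indScale univ (u or ū)`;
* **`eq_C_of_forall_form_of_sign_const`**: `G ∘ V_A⁻¹ = G` for all form-preserving sign-block `A` ⇒ `G = C (coeff 0 G)`.

Use (pub-hodgecm rows A12/A34, census design §5): at a `D₁₂` place the `κ`-isotypic homogeneous Fock polynomials (trivial
twisted character) are the constants (the statement PerL v5 Lemma 4.1(b) claims; kernel-proved here — PerL is a locator,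
not a source).  Reference for the substitution formula: [cite: Folland1989, Prop (4.39)].
Provenance: LEAN-IN-TREE rule (2026-08-18), pub-hodgecm cell, binder-2 lane gen 5; KERNEL only.
-/

set_option autoImplicit false

noncomputable section

open scoped Matrix Kronecker ComplexConjugate BigOperators
open Complex MvPolynomial
open Literature.Analysis.SegalBargmann Literature.NumberTheory.Automorphic Literature.NumberTheory.Automorphic.UnitaryGroup

namespace Literature.NumberTheory.Weil1964

variable {p m ι : Type*} [Fintype p] [DecidableEq p] [DecidableEq m] [Fintype ι] [DecidableEq ι]
variable (e : p × m ≃ ι) {D ε : ι → ℝ} {D₀ : p → ℝ} {D₁ : m → ℝ} {s₀ : ℝ}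

/-- **The centre acts by a uniform scaling of all variables of the place**: for `|u| = 1` the Folland substitution of
the scalar matrix `u · 1` is `indScale univ c` with `c = u` if the place's sign is `+1` and `c = ū` otherwise.
[cite: Folland1989, Prop (4.39)] -/
theorem linSubst_star_follandUnitary_kronecker_scalar (hD : ∀ a j, D (e (a, j)) = D₀ a * D₁ j)
    (hD₁ : ∀ j, D₁ j ≠ 0) (hD₀ : ∀ a, D₀ a ≠ 0) (hε : ∀ a j, ε (e (a, j)) = s₀) (u : ℂ) :
    linSubst (star (follandUnitaryMatrix D ε
        (Matrix.reindex e e (Matrix.diagonal (fun _ : p => u) ⊗ₖ (1 : Matrix m m ℂ))))) =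
      linSubst (indScale (Finset.univ : Finset ι) (if s₀ = 1 then u else star u)) := by
  refine MvPolynomial.algHom_ext fun i => ?_
  obtain ⟨⟨a, j⟩, rfl⟩ := e.surjective i
  rw [linSubst_star_follandUnitary_kronecker_diagonal_X e _ hD hD₁ hD₀ (εV := fun _ => s₀) (εW := fun _ => 1)
    (fun a j => by rw [hε, mul_one]) a j, linSubst_indScale_X, if_pos (Finset.mem_univ _)]
  congr 2
  by_cases hs : s₀ = 1
  · rw [if_pos hs, signConj_of_eq_one (by rw [hε, hs]), Complex.star_def, Complex.conj_conj]
  · rw [if_neg hs, signConj_of_ne_one (by rw [hε]; exact hs)]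

/-- **At a place definite for `V` and `W`, a polynomial fixed by every form-preserving sign-block Kronecker element is
a constant.** [cite: Folland1989, Prop (4.39)] -/
theorem eq_C_of_forall_form_of_sign_const {εV : p → ℝ} {t : p → ℝ} (hD : ∀ a j, D (e (a, j)) = D₀ a * D₁ j)
    (hD₁ : ∀ j, D₁ j ≠ 0) (hD₀ : ∀ a, D₀ a ≠ 0) (hε : ∀ a j, ε (e (a, j)) = s₀) {G : MvPolynomial ι ℂ}
    (hG : ∀ A : GL p ℂ, A ∈ unitaryGroupOfForm (starRingEnd ℂ) ((Matrix.diagonal t).map Complex.ofRealHom) →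
      IsSignBlock εV (A : Matrix p p ℂ) →
      linSubst (star (follandUnitaryMatrix D ε
          (Matrix.reindex e e ((A : Matrix p p ℂ) ⊗ₖ (1 : Matrix m m ℂ))))) G = G) :
    G = C (coeff 0 G) := by
  -- weight `0` for the indicator of ALL variables, from the unimodular scalars `u · 1`
  have hwt : IsWeightedHomogeneous (indWt (Finset.univ : Finset ι)) G 0 := by
    refine isWeightedHomogeneous_indWt_of_linSubst _ fun u hu => ?_
    have hu0 : u ≠ 0 := fun h => by rw [h, norm_zero] at hu; exact zero_ne_one hu
    set u' : ℂ := if s₀ = 1 then u else star u with hu'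
    have hu'n : ‖u'‖ = 1 := by rw [hu']; split_ifs; exact hu; rw [norm_star]; exact hu
    have hu'1 : star u' * u' = 1 := by
      rw [Complex.star_def, ← Complex.normSq_eq_conj_mul_self, Complex.normSq_eq_norm_sq, hu'n]; norm_num
    have hu'0 : u' ≠ 0 := fun h => by rw [h, norm_zero] at hu'n; exact zero_ne_one hu'n
    have h := hG (diagGL (fun _ : p => u') fun _ => hu'0)
      (diagGL_mem_unitaryGroupOfForm _ (fun _ => hu'1) _ t) (by rw [coe_diagGL]; exact isSignBlock_diagonal εV _)
    rw [coe_diagGL, linSubst_star_follandUnitary_kronecker_scalar e hD hD₁ hD₀ hε] at h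
    have hscal : (if s₀ = 1 then u' else star u') = u := by
      rw [hu']; by_cases hs : s₀ = 1
      · rw [if_pos hs, if_pos hs]
      · rw [if_neg hs, if_neg hs, star_star]
    rw [hscal] at h
    rw [pow_zero, one_smul]
    exact h
  rw [← totalDegree_eq_zero_iff_eq_C, totalDegree_eq_zero_iff]
  intro d hd i
  have hw := hwt (mem_support_iff.mp hd)
  rw [weight_indWt] at hw
  exact Finset.sum_eq_zero_iff.mp hw i (Finset.mem_univ i)

end Literature.NumberTheory.Weil1964

end
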